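import Literature.AlgebraicTopology.FundamentalGroup.VanKampenKernel
import Literature.AlgebraicTopology.FundamentalGroup.PathSegment
import HarnessLib

/-!
# Edge paths: paths factoring through a map of an interval are determined up to homotopy by their end parameters

Topic `Literature/AlgebraicTopology/FundamentalGroup`; a small reparametrisation toolkit for
reading off words in fundamental groups of explicit spaces (used by the fact seat
`provefact-Literature.Topology.FourManifolds.exists-cbed50d78a`, the marking of the central
surface of a trisection, to compute the boundary word of a one-holed torus in a free basis).

* `IsParamOn E J δ u v` — the path `δ` factors as `δ = E ∘ φ` through `E : ℝ → X` with a
  continuous parameter `φ : [0, 1] → J ⊆ ℝ` running from `u` to `v`.  Closed under `trans`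
  (parameters concatenate), `symm`, `cast`, `map`, change of `E` on `J`;
* `epath E u v` — the affine `E`-path `t ↦ E (u + (v - u) t)`, `isParamOn_epath` (`J` convex);
* `IsParamOn.homotopicWithin` — **two paths parametrised through the same `E` over a convex `J`
  with the same end parameters are homotopic rel end points inside any `S ⊇ E(J)`** (interpolate
  the parameters linearly; Hatcher's "reparametrisation" remark after Prop. 1.2), and its
  quotient form `IsParamOn.mk_liftPath_eq` for the lifted paths in the subspace `S`;
* bookkeeping for end-point casts in the homotopy quotient (`cast_trans_cast`, `symm_cast`,
  `cast_eq_self`, `mk_liftPath_cast`).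

Relation to `PathSegment.lean` (same topic, same seat): that file is the special case `E = γ.extend`
of one given path `γ`, `J = ℝ`, `S = X`: `PathSegment.segment γ a b` is literally
`epath ⟨γ.extend, γ.continuous_extend⟩ a b` (`segment_eq_epath`, `rfl`), and its reparametrisation
principle `PathSegment.homotopic_of_extend` is recovered from `IsParamOn.homotopicWithin`
(`homotopic_of_extend'`).  The present file is the survivor for new uses: it handles several edge
maps `E` at once, parameter sets `J` smaller than `ℝ` (needed when `E` leaves the subspace `S`
outside `J`), and produces homotopies *inside* `S` (`HomotopicWithin`), which is what reading words
in `π₁` of a subspace requires; `PathSegment.lean` is kept for its existing importers.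

Everything is proved; no named facts.

## References

* A. Hatcher, *Algebraic Topology*, CUP (2002), §1.1 (reparametrisation, after Prop. 1.2).
  [HatcherAT2002]
-/

noncomputable section

open Set Function unitInterval Topology

namespace Literature.AlgebraicTopology.FundamentalGroup

namespace EdgePath

variable {X : Type*} [TopologicalSpace X]

/-! ### Paths parametrised through a map of the line -/

/-- `δ` **is parametrised through `E` over `J` from `u` to `v`**: `δ = E ∘ φ` for a continuous
`φ : [0, 1] → J` with `φ 0 = u`, `φ 1 = v`. [folklore] -/
def IsParamOn (E : ℝ → X) (J : Set ℝ) {a b : X} (δ : Path a b) (u v : ℝ) : Prop :=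
  ∃ φ : I → ℝ, Continuous φ ∧ φ 0 = u ∧ φ 1 = v ∧ (∀ t, φ t ∈ J) ∧ ∀ t, δ t = E (φ t)

variable {E : ℝ → X} {J : Set ℝ} {a b c : X}

/-- The start parameter lies in `J`. [folklore] -/
theorem IsParamOn.left_mem {δ : Path a b} {u v : ℝ} (h : IsParamOn E J δ u v) : u ∈ J := by
  obtain ⟨φ, -, h0, -, hJ, -⟩ := h
  exact h0 ▸ hJ 0

/-- The end parameter lies in `J`. [folklore] -/
theorem IsParamOn.right_mem {δ : Path a b} {u v : ℝ} (h : IsParamOn E J δ u v) : v ∈ J := by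
  obtain ⟨φ, -, -, h1, hJ, -⟩ := h
  exact h1 ▸ hJ 1

/-- The start point is `E u`. [folklore] -/
theorem IsParamOn.source_eq {δ : Path a b} {u v : ℝ} (h : IsParamOn E J δ u v) : a = E u := by
  obtain ⟨φ, -, h0, -, -, hδ⟩ := h
  rw [← δ.source, hδ 0, h0]

/-- The end point is `E v`. [folklore] -/
theorem IsParamOn.target_eq {δ : Path a b} {u v : ℝ} (h : IsParamOn E J δ u v) : b = E v := by
  obtain ⟨φ, -, -, h1, -, hδ⟩ := h
  rw [← δ.target, hδ 1, h1]

/-- **Concatenation**: parameters concatenate. [folklore] -/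
theorem IsParamOn.trans {p : Path a b} {q : Path b c} {u v w : ℝ} (hp : IsParamOn E J p u v)
    (hq : IsParamOn E J q v w) : IsParamOn E J (p.trans q) u w := by
  obtain ⟨φ, hφ, hφ0, hφ1, hφJ, hpφ⟩ := hp
  obtain ⟨ψ, hψ, hψ0, hψ1, hψJ, hqψ⟩ := hq
  refine ⟨fun t => if (t : ℝ) ≤ 1 / 2 then φ (Set.projIcc 0 1 zero_le_one (2 * t))
      else ψ (Set.projIcc 0 1 zero_le_one (2 * t - 1)), ?_, ?_, ?_, ?_, ?_⟩
  · refine continuous_if_le (by fun_prop) continuous_const ?_ ?_ ?_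
    · exact (hφ.comp (continuous_projIcc.comp (by fun_prop))).continuousOn
    · exact (hψ.comp (continuous_projIcc.comp (by fun_prop))).continuousOn
    · rintro t ht
      have h2 : 2 * (t : ℝ) = 1 := by linarith
      have h1 : Set.projIcc (0 : ℝ) 1 zero_le_one (2 * t) = 1 := by
        rw [h2]; exact Set.projIcc_right _
      have h0 : Set.projIcc (0 : ℝ) 1 zero_le_one (2 * t - 1) = 0 := by
        rw [h2, sub_self]; exact Set.projIcc_left _
      rw [h1, h0, hφ1, hψ0]
  · have h : ((0 : I) : ℝ) ≤ 1 / 2 := by norm_num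
    simp only [h, if_true]
    rw [← hφ0]; congr 1
    rw [show (2 : ℝ) * (0 : I) = 0 by norm_num]; exact Set.projIcc_left _
  · have h : ¬ ((1 : I) : ℝ) ≤ 1 / 2 := by norm_num
    simp only [h, if_false]
    rw [← hψ1]; congr 1
    rw [show (2 : ℝ) * (1 : I) - 1 = 1 by norm_num]; exact Set.projIcc_right _
  · intro t
    by_cases h : (t : ℝ) ≤ 1 / 2
    · simp only [h, if_true]; exact hφJ _
    · simp only [h, if_false]; exact hψJ _
  · intro t
    rw [Path.trans_apply]
    by_cases h : (t : ℝ) ≤ 1 / 2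
    · simp only [h, if_true, dif_pos]
      rw [hpφ]; congr 2
      exact (Set.projIcc_of_mem zero_le_one ⟨by linarith [t.2.1], by linarith⟩).symm
    · simp only [h, if_false, dif_neg, not_false_eq_true]
      rw [hqψ]; congr 2
      exact (Set.projIcc_of_mem zero_le_one ⟨by linarith, by linarith [t.2.2]⟩).symm

/-- **Reversal** swaps the end parameters. [folklore] -/
theorem IsParamOn.symm {p : Path a b} {u v : ℝ} (hp : IsParamOn E J p u v) : IsParamOn E J p.symm v u := by
  obtain ⟨φ, hφ, hφ0, hφ1, hφJ, hpφ⟩ := hp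
  refine ⟨fun t => φ (unitInterval.symm t), hφ.comp unitInterval.continuous_symm, by simpa using hφ1,
    by simpa using hφ0, fun t => hφJ _, fun t => ?_⟩
  show p (unitInterval.symm t) = E (φ (unitInterval.symm t))
  exact hpφ _

/-- Casting the end points does not change the parametrisation. [folklore] -/
theorem IsParamOn.cast {p : Path a b} {u v : ℝ} (hp : IsParamOn E J p u v) {a' b' : X} (ha : a' = a)
    (hb : b' = b) : IsParamOn E J (p.cast ha hb) u v := by
  obtain ⟨φ, hφ, hφ0, hφ1, hφJ, hpφ⟩ := hp
  exact ⟨φ, hφ, hφ0, hφ1, hφJ, fun t => by rw [Path.cast_coe, hpφ]⟩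

/-- Images: `f ∘ δ` is parametrised through `f ∘ E`. [folklore] -/
theorem IsParamOn.map {Y : Type*} [TopologicalSpace Y] {f : X → Y} (hf : Continuous f) {p : Path a b}
    {u v : ℝ} (hp : IsParamOn E J p u v) : IsParamOn (f ∘ E) J (p.map hf) u v := by
  obtain ⟨φ, hφ, hφ0, hφ1, hφJ, hpφ⟩ := hp
  exact ⟨φ, hφ, hφ0, hφ1, hφJ, fun t => by simp [hpφ t]⟩

/-- Changing `E` on `J` does not matter. [folklore] -/
theorem IsParamOn.congr {E' : ℝ → X} {p : Path a b} {u v : ℝ} (hp : IsParamOn E J p u v)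
    (h : ∀ r ∈ J, E r = E' r) : IsParamOn E' J p u v := by
  obtain ⟨φ, hφ, hφ0, hφ1, hφJ, hpφ⟩ := hp
  exact ⟨φ, hφ, hφ0, hφ1, hφJ, fun t => by rw [hpφ, h _ (hφJ t)]⟩

/-- Enlarging `J` does not matter. [folklore] -/
theorem IsParamOn.mono {J' : Set ℝ} {p : Path a b} {u v : ℝ} (hp : IsParamOn E J p u v) (hJ : J ⊆ J') :
    IsParamOn E J' p u v := by
  obtain ⟨φ, hφ, hφ0, hφ1, hφJ, hpφ⟩ := hp
  exact ⟨φ, hφ, hφ0, hφ1, fun t => hJ (hφJ t), hpφ⟩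

/-- Pointwise equal paths have the same parametrisations. [folklore] -/
theorem IsParamOn.of_eq {p q : Path a b} {u v : ℝ} (hp : IsParamOn E J p u v) (h : ∀ t, q t = p t) :
    IsParamOn E J q u v := by
  obtain ⟨φ, hφ, hφ0, hφ1, hφJ, hpφ⟩ := hp
  exact ⟨φ, hφ, hφ0, hφ1, hφJ, fun t => by rw [h, hpφ]⟩

/-- **A path with an explicit parameter**: if `δ t = E (φ t)` for a continuous `φ` into `J`, then
`δ` is parametrised through `E` from `φ 0` to `φ 1`. [folklore] -/
theorem isParamOn_of_forall {p : Path a b} (φ : I → ℝ) (hφ : Continuous φ) (hφJ : ∀ t, φ t ∈ J)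
    (h : ∀ t, p t = E (φ t)) {u v : ℝ} (hu : φ 0 = u) (hv : φ 1 = v) : IsParamOn E J p u v :=
  ⟨φ, hφ, hu, hv, hφJ, h⟩

/-- A constant path at `E u` is parametrised with constant parameter `u ∈ J`. [folklore] -/
theorem isParamOn_refl {u : ℝ} (hu : u ∈ J) {a : X} (ha : a = E u) : IsParamOn E J (Path.refl a) u u :=
  ⟨fun _ => u, continuous_const, rfl, rfl, fun _ => hu, fun _ => by simpa using ha⟩

/-! ### The affine `E`-path -/

/-- **The affine `E`-path** from parameter `u` to parameter `v`: `t ↦ E (u + (v - u) t)`. [folklore] -/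
def epath (E : C(ℝ, X)) (u v : ℝ) : Path (E u) (E v) where
  toFun t := E (u + (v - u) * t)
  continuous_toFun := E.continuous.comp (by fun_prop)
  source' := by simp
  target' := by simp

/-- The affine `E`-path, evaluated. [folklore] -/
theorem epath_apply (E : C(ℝ, X)) (u v : ℝ) (t : I) : epath E u v t = E (u + (v - u) * t) := rfl

/-- The affine parameter stays in a convex `J ∋ u, v`. [folklore] -/
theorem affine_mem {J : Set ℝ} (hJ : Convex ℝ J) {u v : ℝ} (hu : u ∈ J) (hv : v ∈ J) (t : I) :
    u + (v - u) * t ∈ J := by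
  have := hJ hu hv (sub_nonneg.2 t.2.2) t.2.1 (sub_add_cancel 1 (t : ℝ))
  simp only [smul_eq_mul] at this
  convert this using 1; ring

/-- **The affine `E`-path is parametrised through `E` from `u` to `v`** (`J` convex containing `u, v`).
[folklore] -/
theorem isParamOn_epath (E : C(ℝ, X)) {J : Set ℝ} (hJ : Convex ℝ J) {u v : ℝ} (hu : u ∈ J) (hv : v ∈ J) :
    IsParamOn E J (epath E u v) u v :=
  ⟨fun t => u + (v - u) * t, by fun_prop, by simp, by simp, affine_mem hJ hu hv, fun _ => rfl⟩

/-- The affine `E`-path with equal end parameters is constant. [folklore] -/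
theorem epath_self (E : C(ℝ, X)) (u : ℝ) : epath E u u = Path.refl (E u) := by
  ext t; simp [epath_apply]

/-! ### The reparametrisation principle -/

/-- **Two paths parametrised through the same map over a convex parameter set, with the same end
parameters, are homotopic rel end points inside any set containing the image of the parameter
set** (interpolate the parameters linearly). [cite: HatcherAT2002, §1.1 (after Prop. 1.2)] -/
theorem IsParamOn.homotopicWithin {S : Set X} (hJ : Convex ℝ J) (hE : ContinuousOn E J)
    (hES : MapsTo E J S) {δ₁ δ₂ : Path a b} {u v : ℝ} (h₁ : IsParamOn E J δ₁ u v)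
    (h₂ : IsParamOn E J δ₂ u v) : VanKampen.HomotopicWithin S δ₁ δ₂ := by
  obtain ⟨φ, hφ, hφ0, hφ1, hφJ, h₁⟩ := h₁
  obtain ⟨ψ, hψ, hψ0, hψ1, hψJ, h₂⟩ := h₂
  have hmem : ∀ q : I × I, (1 - (q.1 : ℝ)) * φ q.2 + (q.1 : ℝ) * ψ q.2 ∈ J := fun q => by
    have := hJ (hφJ q.2) (hψJ q.2) (sub_nonneg.2 q.1.2.2) q.1.2.1 (sub_add_cancel 1 (q.1 : ℝ))
    simpa only [smul_eq_mul] using this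
  have hcont : Continuous fun q : I × I => E ((1 - (q.1 : ℝ)) * φ q.2 + (q.1 : ℝ) * ψ q.2) := by
    have hin : Continuous fun q : I × I => (⟨(1 - (q.1 : ℝ)) * φ q.2 + (q.1 : ℝ) * ψ q.2, hmem q⟩ : J) := by
      refine Continuous.subtype_mk ?_ _
      fun_prop
    have := (continuousOn_iff_continuous_restrict.1 hE).comp hin
    exact this
  refine ⟨{ toFun := fun q => E ((1 - (q.1 : ℝ)) * φ q.2 + (q.1 : ℝ) * ψ q.2)
            continuous_toFun := hcont
            map_zero_left := fun t => by simp [h₁ t]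
            map_one_left := fun t => by simp [h₂ t]
            prop' := fun s t ht => ?_ }, fun q => hES (hmem q)⟩
  simp only [mem_insert_iff, mem_singleton_iff] at ht
  show E ((1 - (s : ℝ)) * φ t + (s : ℝ) * ψ t) = δ₁ t
  rcases ht with rfl | rfl
  · rw [h₁, hφ0, hψ0]; congr 1; ring
  · rw [h₁, hφ1, hψ1]; congr 1; ring

/-- **Quotient form in a subspace**: two paths inside `S`, parametrised through the same `E` over a
convex `J` with `E(J) ⊆ S` and the same end parameters, lift to homotopic paths of `S`. [folklore] -/
theorem IsParamOn.mk_liftPath_eq {S : Set X} (hJ : Convex ℝ J) (hE : ContinuousOn E J)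
    (hES : MapsTo E J S) {δ₁ δ₂ : Path a b} {u v : ℝ} (h₁ : IsParamOn E J δ₁ u v)
    (h₂ : IsParamOn E J δ₂ u v) (hδ₁ : ∀ t, δ₁ t ∈ S) (hδ₂ : ∀ t, δ₂ t ∈ S) :
    Path.Homotopic.Quotient.mk (VanKampen.liftPath S δ₁ hδ₁) =
      Path.Homotopic.Quotient.mk (VanKampen.liftPath S δ₂ hδ₂) :=
  Path.Homotopic.Quotient.eq.2 ((h₁.homotopicWithin hJ hE hES h₂).liftPath hδ₁ hδ₂)

/-! ### Relation to `PathSegment` -/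

/-- `PathSegment.segment` is the affine `E`-path of `E = γ.extend`. [folklore] -/
theorem segment_eq_epath {x y : X} (γ : Path x y) (a b : ℝ) :
    PathSegment.segment γ a b = epath ⟨γ.extend, γ.continuous_extend⟩ a b := rfl

/-- Two paths parametrised through the same `E` over a convex `J` (no subspace) with the same end
parameters are homotopic. [folklore] -/
theorem IsParamOn.homotopic (hJ : Convex ℝ J) (hE : ContinuousOn E J) {δ₁ δ₂ : Path a b} {u v : ℝ}
    (h₁ : IsParamOn E J δ₁ u v) (h₂ : IsParamOn E J δ₂ u v) : δ₁.Homotopic δ₂ := by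
  obtain ⟨F, -⟩ := h₁.homotopicWithin hJ hE (mapsTo_univ E J) h₂
  exact ⟨F⟩

/-- `PathSegment.homotopic_of_extend` recovered: two paths factoring through `γ.extend` with
continuous parameters agreeing at the end points are homotopic. [folklore] -/
theorem homotopic_of_extend' {x y : X} (γ : Path x y) (δ₁ δ₂ : Path a b) (p₁ p₂ : I → ℝ)
    (hp₁ : Continuous p₁) (hp₂ : Continuous p₂) (h₁ : ∀ t, δ₁ t = γ.extend (p₁ t))
    (h₂ : ∀ t, δ₂ t = γ.extend (p₂ t)) (h0 : p₁ 0 = p₂ 0) (h1 : p₁ 1 = p₂ 1) : δ₁.Homotopic δ₂ :=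
  (isParamOn_of_forall (E := γ.extend) (J := univ) p₁ hp₁ (fun _ => mem_univ _) h₁ rfl rfl).homotopic
    convex_univ γ.continuous_extend.continuousOn
    (isParamOn_of_forall (E := γ.extend) (J := univ) p₂ hp₂ (fun _ => mem_univ _) h₂ h0.symm h1.symm)

/-! ### End-point casts in the homotopy quotient -/

/-- Casts along reflexive end-point equalities are the identity. [folklore] -/
theorem cast_eq_self {a b : X} (A : Path.Homotopic.Quotient a b) (ha : a = a) (hb : b = b) :
    A.cast ha hb = A :=
  Path.Homotopic.Quotient.cast_rfl_rfl A

/-- Casts compose through concatenation. [folklore] -/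
theorem cast_trans_cast {a b c a' b' c' : X} (A : Path.Homotopic.Quotient a b)
    (B : Path.Homotopic.Quotient b c) (ha : a' = a) (hb : b' = b) (hc : c' = c) :
    (A.cast ha hb).trans (B.cast hb hc) = (A.trans B).cast ha hc := by
  subst ha hb hc
  simp only [Path.Homotopic.Quotient.cast_rfl_rfl]

/-- Casts commute with reversal. [folklore] -/
theorem symm_cast {a b a' b' : X} (A : Path.Homotopic.Quotient a b) (ha : a' = a) (hb : b' = b) :
    (A.cast ha hb).symm = A.symm.cast hb ha := by
  subst ha hb
  simp only [Path.Homotopic.Quotient.cast_rfl_rfl]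

/-- The lift of a cast path is the cast of the lift. [folklore] -/
theorem mk_liftPath_cast {S : Set X} {a b a' b' : X} (p : Path a b) (ha : a' = a) (hb : b' = b)
    (h : ∀ t, (p.cast ha hb) t ∈ S) (h' : ∀ t, p t ∈ S) :
    Path.Homotopic.Quotient.mk (VanKampen.liftPath S (p.cast ha hb) h) =
      (Path.Homotopic.Quotient.mk (VanKampen.liftPath S p h')).cast
        (Subtype.ext ha : (⟨a', (p.cast ha hb).source ▸ h 0⟩ : S) = ⟨a, p.source ▸ h' 0⟩)
        (Subtype.ext hb : (⟨b', (p.cast ha hb).target ▸ h 1⟩ : S) = ⟨b, p.target ▸ h' 1⟩) := by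
  subst ha hb
  rw [Path.Homotopic.Quotient.cast_rfl_rfl]
  rfl

/-- The lift of a mapped-then-cast path: pointwise description suffices to identify lifts. [folklore] -/
theorem mk_liftPath_congr {S : Set X} {a b : X} (p q : Path a b) (hpq : ∀ t, p t = q t)
    (hp : ∀ t, p t ∈ S) (hq : ∀ t, q t ∈ S) :
    Path.Homotopic.Quotient.mk (VanKampen.liftPath S p hp) =
      Path.Homotopic.Quotient.mk (VanKampen.liftPath S q hq) := by
  have : p = q := Path.ext (funext hpq)
  subst this
  rfl

end EdgePath

end Literature.AlgebraicTopology.FundamentalGroup
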